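import Summits.AnomalousDissipation.AnomalousDissipation.Theorems.SawtoothPulseCascadeK2ParallelDatum
import Summits.AnomalousDissipation.AnomalousDissipation.Theorems.SawtoothPulseCascadeK2InjectionH
import Literature.Analysis.FluidPDE.TorusHeatFourierMultiplier
import Literature.Analysis.FunctionSpaces.TorusShearKoopman

/-!
# The residual comb class `ShearCombDatum` is invariant under the parallel half pulse
(route `AnomalousDissipation/SawtoothPulseCascade`, crux K2″ = stmt-AnomalousDissipation-19696
`K2LinearisedCascadeGrowth`, registered line `phase-cocycle`; helper serving both registered stubs
`stub_injectionPhase` / `stub_phaseCocycle`)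

K2″ quantifies over residual-comb injections `ShearCombDatum (P.N j₀) hz w₀`: `w₀ = g(x_⊥) e_∥`, `g` smooth,
`1`-periodic and Fourier-supported on the ODD multiples of `N_{j₀}` (both the cosine and the sine moment
`∫₀¹ g(y) cos(2πmy) dy`, `∫₀¹ g(y) sin(2πmy) dy` vanish for every other `m ∈ ℤ`).  Along the half pulse
PARALLEL to the comb the classical linearised response is the parallel heat flow `h(t, x_⊥) e_∥`
(`K2Classical.parallel_H_unique` / `_V_unique`, p456854; `exists_heatProfile`, p458821).  This file proves
that the heat flow keeps the comb class, so that the state handed to the next, PERPENDICULAR half pulse —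
where the Kelvin–Helmholtz / Orr content of K2″ lives — is again a residual comb of the SAME frequency:

* §1–§2 (Fourier glue on `𝕋¹`): the complex Fourier coefficient of a continuous real `1`-periodic `f`
  (Mathlib `fourierCoeff` of `AddCircle.liftIco 1 0 f`, and the tree's torus coefficient `mFourierCoeff` of
  the coordinate function `x ↦ f (repr x 0)` on `𝕋¹`, `Torus.mFourierCoeff_comp_eval_single`) equals
  `∫₀¹ f cos(2πm·) − i ∫₀¹ f sin(2πm·)` (`fourierCoeff_liftIco_ofReal`), hence vanishes iff both moments of
  `ShearCombDatum` vanish (`fourierCoeff_liftIco_ofReal_eq_zero_iff`); coordinate fields on `𝕋¹` are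
  (jointly) smooth with Laplacian `h''` (`isSmoothSpaceTimeOn_coordFun_one`, `laplacian_coordFun_one`).
* §3 `heatProfile_moments_eq_zero`: a heat profile `h` on `[a, b]` (jointly smooth, `1`-periodic,
  `∂ₜ|_{[a,b]} h = ν h''`) whose `m`-th moments vanish at `a` has vanishing `m`-th moments at every
  `t ∈ [a, b]` — the coordinate field is a classical heat solution on `𝕋¹` and the tree's
  `Torus.mFourierCoeff_heat_eq_zero` (p464566) applies.
* §4 `shearCombDatum_parallel_H` / `shearCombDatum_parallel_V`: for `δ₀ > 0`, `d > 0`, `ν > 0`, every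
  classical linearised response on the H (resp. V) half-slot of phase `j` to a horizontal (resp. vertical)
  residual comb `w₀` of frequency `N_j` satisfies `ShearCombDatum (P.N j) hz (w t)` and `‖w(t)‖² ≤ ‖w₀‖²`
  at every time of the slot.
* §5, in the shape of the registered stubs' windows: `k2_injection_H_comb` (H injection window
  `[tInject j₀ true, tStart (j₀+1)]`: comb class on the H half), `k2_injection_V_comb` (V injection window =
  the V half-slot: comb class on the whole window), `k2_injection_V_comb_next` (the datum handed to the H
  pulse of phase `j₀ + 1` is a vertical residual comb of frequency `N_{j₀}`, i.e. relative streamwise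
  wavenumbers = odd multiples of `1/ρN`, with `‖·‖² ≤ ‖w₀‖²`).

So the open content of stub A (`hz = true`, `γ ∈ (5.77, 8]`, after `K2Classical.injectionPhase_of_le_577`,
p467852) and the first transfer of stub B start from a residual comb PERPENDICULAR to the running pulse,
of known frequency and with no energy gained — the input of the per-streamwise-mode reduction
(ad-lit `Torus.linearisedNS_mFourierCoeff_eq_zero_of_streamwise_mode`, p463588).
-/

-- `Summit.<Summit>.<Problem>` is the tree's mandated summit-side namespace (CONVENTIONS §2); for this
-- single-conjunct summit the two coincide, so the duplicate is deliberate (lakefile: off for `Summits`).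
set_option linter.dupNamespace false

noncomputable section

namespace Summit.AnomalousDissipation.AnomalousDissipation.Theorems.SawtoothPulseCascade.K2Classical

open Set MeasureTheory UnitAddTorus
open scoped ContDiff
open Literature.Analysis Literature.Analysis.FunctionSpaces Literature.Analysis.FluidPDE
open Literature.Analysis.FluidPDE.SawtoothCascade
open Literature.Analysis.FluidPDE.SawtoothCascade.CascadeParams

/-! ## §1 Fourier coefficients of a real `1`-periodic function: the complex coefficient vs the
cosine / sine moments of `ShearCombDatum` -/

/-- A continuous `1`-periodic `F : ℝ → ℂ` descends to a continuous function on `𝕋 = ℝ/ℤ`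
(Mathlib `AddCircle.liftIco`). -/
theorem continuous_liftIco_of_periodic {F : ℝ → ℂ} (hF : Continuous F) (hper : Function.Periodic F 1) :
    Continuous (AddCircle.liftIco 1 0 F) :=
  AddCircle.liftIco_zero_continuous (by rw [← hper 0, zero_add]) hF.continuousOn

/-- `e^{2πi(-m)x} · f(x) = f(x)cos(2πmx) − i·f(x)sin(2πmx)` for real `f(x)`. -/
theorem fourier_neg_coe_mul_ofReal (m : ℤ) (x r : ℝ) :
    (fourier (-m) (x : AddCircle (1 : ℝ)) : ℂ) * (r : ℂ) =
      ((r * Real.cos (2 * Real.pi * m * x) : ℝ) : ℂ) -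
        Complex.I * ((r * Real.sin (2 * Real.pi * m * x) : ℝ) : ℂ) := by
  rw [fourier_coe_apply]
  have h : (2 * (Real.pi : ℂ) * Complex.I * ((-m : ℤ) : ℂ) * (x : ℂ) / ((1 : ℝ) : ℂ)) =
      ((-(2 * Real.pi * m * x) : ℝ) : ℂ) * Complex.I := by
    push_cast
    ring
  rw [h, Complex.exp_mul_I, ← Complex.ofReal_cos, ← Complex.ofReal_sin, Real.cos_neg, Real.sin_neg]
  push_cast
  ring

/-- **The `m`-th Fourier coefficient of a continuous real `f` on `[0,1)` in terms of its cosine and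
sine moments**: `𝓕(f)(m) = ∫₀¹ f cos(2πm·) − i ∫₀¹ f sin(2πm·)`. -/
theorem fourierCoeff_liftIco_ofReal {f : ℝ → ℝ} (hf : Continuous f) (m : ℤ) :
    fourierCoeff (AddCircle.liftIco 1 0 (fun y => (f y : ℂ))) m =
      ((∫ y in (0 : ℝ)..1, f y * Real.cos (2 * Real.pi * m * y) : ℝ) : ℂ) -
        Complex.I * ((∫ y in (0 : ℝ)..1, f y * Real.sin (2 * Real.pi * m * y) : ℝ) : ℂ) := by
  rw [fourierCoeff_eq_intervalIntegral _ m 0]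
  have h01 : (0 : ℝ) ≤ 0 + 1 := by norm_num
  have hcongr : ∫ x in (0 : ℝ)..0 + 1,
      (fourier (-m) (x : AddCircle (1 : ℝ)) : ℂ) • AddCircle.liftIco 1 0 (fun y => (f y : ℂ)) (x : AddCircle (1 : ℝ)) =
      ∫ x in (0 : ℝ)..0 + 1, (((f x * Real.cos (2 * Real.pi * m * x) : ℝ) : ℂ) -
        Complex.I * ((f x * Real.sin (2 * Real.pi * m * x) : ℝ) : ℂ)) := by
    refine intervalIntegral.integral_congr_Ioo_of_le h01 fun x hx => ?_
    show (fourier (-m) (x : AddCircle (1 : ℝ)) : ℂ) • AddCircle.liftIco 1 0 (fun y => (f y : ℂ)) (x : AddCircle (1 : ℝ)) = _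
    rw [AddCircle.liftIco_coe_apply (Ioo_subset_Ico_self hx), smul_eq_mul, fourier_neg_coe_mul_ofReal]
  rw [hcongr, zero_add]
  have hc1 : Continuous fun x => ((f x * Real.cos (2 * Real.pi * m * x) : ℝ) : ℂ) :=
    Complex.continuous_ofReal.comp (hf.mul (by fun_prop))
  have hc2 : Continuous fun x => ((f x * Real.sin (2 * Real.pi * m * x) : ℝ) : ℂ) :=
    Complex.continuous_ofReal.comp (hf.mul (by fun_prop))
  have hi1 : IntervalIntegrable (fun x => ((f x * Real.cos (2 * Real.pi * m * x) : ℝ) : ℂ)) volume 0 1 :=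
    hc1.intervalIntegrable _ _
  have hi2 : IntervalIntegrable (fun x => Complex.I * ((f x * Real.sin (2 * Real.pi * m * x) : ℝ) : ℂ))
      volume 0 1 :=
    (continuous_const.mul hc2).intervalIntegrable _ _
  rw [intervalIntegral.integral_sub hi1 hi2, intervalIntegral.integral_const_mul,
    intervalIntegral.integral_ofReal, intervalIntegral.integral_ofReal,
    show (1 : ℝ) / 1 = 1 by norm_num, one_smul]

/-- The complex coefficient vanishes iff both real moments vanish. -/
theorem fourierCoeff_liftIco_ofReal_eq_zero_iff {f : ℝ → ℝ} (hf : Continuous f) (m : ℤ) :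
    fourierCoeff (AddCircle.liftIco 1 0 (fun y => (f y : ℂ))) m = 0 ↔
      (∫ y in (0 : ℝ)..1, f y * Real.cos (2 * Real.pi * m * y)) = 0 ∧
        (∫ y in (0 : ℝ)..1, f y * Real.sin (2 * Real.pi * m * y)) = 0 := by
  rw [fourierCoeff_liftIco_ofReal hf m]
  constructor
  · intro h
    have hre := congrArg Complex.re h
    have him := congrArg Complex.im h
    simp only [Complex.sub_re, Complex.ofReal_re, Complex.mul_re, Complex.I_re, Complex.ofReal_im,
      Complex.I_im, Complex.sub_im, Complex.mul_im, Complex.zero_re, Complex.zero_im] at hre him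
    constructor <;> linarith
  · rintro ⟨h1, h2⟩
    rw [h1, h2]
    simp

/-! ## §2 Coordinate functions on `𝕋¹` -/

/-- The `m e₀`-mode of the coordinate function `x ↦ f (repr x 0)` on `𝕋¹` is the circle coefficient
of the descended function (tree `Torus.mFourierCoeff_comp_eval_single`). -/
theorem mFourierCoeff_coordFun_one {f : ℝ → ℝ} (hf : Continuous f) (hper : Function.Periodic f 1) (m : ℤ) :
    mFourierCoeff (fun x : UnitAddTorus (Fin 1) => ((f (Torus.repr x 0) : ℝ) : ℂ)) (Pi.single 0 m) =
      fourierCoeff (AddCircle.liftIco 1 0 (fun y => (f y : ℂ))) m := by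
  have hG : Continuous (AddCircle.liftIco 1 0 (fun y => (f y : ℂ))) :=
    continuous_liftIco_of_periodic (Complex.continuous_ofReal.comp hf) (fun y => by simp [hper y])
  have hfun : (fun x : UnitAddTorus (Fin 1) => ((f (Torus.repr x 0) : ℝ) : ℂ)) =
      fun x => AddCircle.liftIco 1 0 (fun y => (f y : ℂ)) (x 0) := by
    funext x
    rfl
  rw [hfun]
  exact Torus.mFourierCoeff_comp_eval_single (d := Fin 1) hG 0 m

/-- A coordinate function `x ↦ H (repr x 0)` on `𝕋¹` with `H` smooth and `1`-periodic is smooth. -/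
theorem isSmooth_coordFun_one {H : ℝ → ℝ} (hH : ContDiff ℝ ∞ H) (hper : Function.Periodic H 1) :
    Torus.IsSmooth (fun z : UnitAddTorus (Fin 1) => H (Torus.repr z 0)) := by
  have hl : Torus.lift (fun z : UnitAddTorus (Fin 1) => H (Torus.repr z 0)) = fun v => H (v 0) :=
    funext fun v => Torus.lift_coordFun_apply hper 0 v
  unfold Torus.IsSmooth
  rw [hl]
  exact hH.comp (contDiff_euclidean.1 contDiff_id 0)

/-- The derivative of a `1`-periodic function is `1`-periodic. -/
private theorem periodic_deriv_one {g : ℝ → ℝ} (hg : Function.Periodic g 1) : Function.Periodic (deriv g) 1 := by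
  intro s
  have h : (fun x => g (x + 1)) = g := funext hg
  rw [← deriv_comp_add_const g 1 s, h]

/-- The Laplacian of a coordinate function on `𝕋¹` is the second derivative of the profile. -/
theorem laplacian_coordFun_one {H : ℝ → ℝ} (hH : ContDiff ℝ ∞ H) (hper : Function.Periodic H 1)
    (x : UnitAddTorus (Fin 1)) :
    Torus.laplacian (fun z : UnitAddTorus (Fin 1) => H (Torus.repr z 0)) x = deriv (deriv H) (Torus.repr x 0) := by
  rw [Torus.laplacian_eq_sum_partialDeriv_partialDeriv (isSmooth_coordFun_one hH hper), Fin.sum_univ_one]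
  have h1 : Torus.partialDeriv 0 (fun z : UnitAddTorus (Fin 1) => H (Torus.repr z 0)) =
      fun z => deriv H (Torus.repr z 0) :=
    funext fun z => Torus.partialDeriv_coordFun_self hper 0 z
  rw [h1, Torus.partialDeriv_coordFun_self (periodic_deriv_one hper) 0]

/-- A time-dependent coordinate field `(t, x) ↦ h(t, repr x 0)` on `𝕋¹` with jointly smooth,
spatially `1`-periodic profile is jointly smooth. -/
theorem isSmoothSpaceTimeOn_coordFun_one {S : Set ℝ} {h : ℝ → ℝ → ℝ}
    (hh : ContDiffOn ℝ ∞ (Function.uncurry h) (S ×ˢ univ)) (hper : ∀ t ∈ S, Function.Periodic (h t) 1) :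
    Torus.IsSmoothSpaceTimeOn S (fun t (z : UnitAddTorus (Fin 1)) => h t (Torus.repr z 0)) := by
  have hcoord : ContDiff ℝ ∞ fun v : EuclideanSpace ℝ (Fin 1) => v 0 := contDiff_euclidean.1 contDiff_id 0
  have hcomp : ContDiffOn ℝ ∞ (fun p : ℝ × EuclideanSpace ℝ (Fin 1) => Function.uncurry h (p.1, p.2 0))
      (S ×ˢ univ) := by
    refine hh.comp (contDiffOn_fst.prodMk ((hcoord.comp contDiff_snd).contDiffOn)) ?_
    intro p hp
    exact mk_mem_prod (mem_prod.1 hp).1 (mem_univ _)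
  unfold Torus.IsSmoothSpaceTimeOn
  refine hcomp.congr fun p hp => ?_
  rw [Torus.stLift_apply]
  have h1 := Torus.lift_coordFun_apply (g := fun s => h p.1 s) (hper p.1 (mem_prod.1 hp).1) 0 p.2
  rw [Torus.lift_apply] at h1
  exact h1

/-! ## §3 Heat profiles preserve vanishing Fourier moments -/

/-- **Heat profiles preserve the vanishing of Fourier moments.** Let `h` be a heat profile on `[a, b]`
(`a < b`): jointly smooth on `[a, b] × ℝ`, `1`-periodic in space, `∂ₜ|_{[a,b]} h = ν ∂²_y h` pointwise.
If the `m`-th cosine and sine moments of `h(a, ·)` over `[0, 1]` vanish, then so do those of `h(t, ·)`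
for every `t ∈ [a, b]` (the coordinate field on `𝕋¹` is a classical heat solution; tree
`Torus.mFourierCoeff_heat_eq_zero`). -/
theorem heatProfile_moments_eq_zero {a b ν : ℝ} (hab : a < b) {h : ℝ → ℝ → ℝ}
    (hh : ContDiffOn ℝ ∞ (Function.uncurry h) (Icc a b ×ˢ univ))
    (hper : ∀ t ∈ Icc a b, Function.Periodic (h t) 1)
    (heat : ∀ t ∈ Icc a b, ∀ y, derivWithin (fun τ => h τ y) (Icc a b) t = ν * deriv (deriv (h t)) y)
    {m : ℤ} (hcos : (∫ y in (0 : ℝ)..1, h a y * Real.cos (2 * Real.pi * m * y)) = 0)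
    (hsin : (∫ y in (0 : ℝ)..1, h a y * Real.sin (2 * Real.pi * m * y)) = 0)
    {t : ℝ} (ht : t ∈ Icc a b) :
    (∫ y in (0 : ℝ)..1, h t y * Real.cos (2 * Real.pi * m * y)) = 0 ∧
      (∫ y in (0 : ℝ)..1, h t y * Real.sin (2 * Real.pi * m * y)) = 0 := by
  set θ : ℝ → UnitAddTorus (Fin 1) → ℝ := fun s z => h s (Torus.repr z 0) with hθ_def
  have hθ : Torus.IsSmoothSpaceTimeOn (Icc a b) θ := isSmoothSpaceTimeOn_coordFun_one hh hper
  have heq : ∀ s ∈ Icc a b, ∀ z, Torus.timeDerivWithin (Icc a b) θ s z = ν * Torus.laplacian (θ s) z := by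
    intro s hs z
    show derivWithin (fun τ => h τ (Torus.repr z 0)) (Icc a b) s = _
    rw [heat s hs, laplacian_coordFun_one (contDiff_slice_of_contDiffOn_uncurry hh hs) (hper s hs)]
  have ha : a ∈ Icc a b := ⟨le_rfl, hab.le⟩
  have hca : Continuous (h a) := (contDiff_slice_of_contDiffOn_uncurry hh ha).continuous
  have hct : Continuous (h t) := (contDiff_slice_of_contDiffOn_uncurry hh ht).continuous
  have hk0 : mFourierCoeff (fun z => (θ a z : ℂ)) (Pi.single 0 m) = 0 := by
    rw [hθ_def, mFourierCoeff_coordFun_one hca (hper a ha) m, fourierCoeff_liftIco_ofReal_eq_zero_iff hca m]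
    exact ⟨hcos, hsin⟩
  have hkt := Torus.mFourierCoeff_heat_eq_zero hab hθ heq hk0 ht
  rw [hθ_def, mFourierCoeff_coordFun_one hct (hper t ht) m, fourierCoeff_liftIco_ofReal_eq_zero_iff hct m] at hkt
  exact hkt

/-! ## §4 The residual comb class along the parallel half pulse of the cascade -/

/-- The one-sided time derivative within a non-degenerate sub-interval `[a', b'] ⊆ [a, b]` of a field
jointly smooth on `[a, b]` agrees with the one within `[a, b]`. -/
private theorem timeDerivWithin_Icc_eq_of_subset_C {a b a' b' : ℝ} (hlt : a' < b')
    (hsub : Icc a' b' ⊆ Icc a b) {w : ℝ → UnitAddTorus (Fin 2) → EuclideanSpace ℝ (Fin 2)}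
    (hw : Torus.IsSmoothSpaceTimeOn (Icc a b) w) {t : ℝ} (ht : t ∈ Icc a' b')
    (x : UnitAddTorus (Fin 2)) :
    Torus.timeDerivWithin (Icc a' b') w t x = Torus.timeDerivWithin (Icc a b) w t x :=
  ((hw.hasDerivWithinAt_slice (hsub ht) x).mono hsub).derivWithin (uniqueDiffOn_Icc hlt t ht)

/-- The horizontal parallel profile `H(x₂) e₁` in the normal form of `ShearCombDatum _ true`. -/
theorem parallel_true_eq (H : ℝ → ℝ) :
    (fun y : UnitAddTorus (Fin 2) => H (Torus.repr y 1) • EuclideanSpace.single (0 : Fin 2) (1 : ℝ)) =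
      fun x => if true then WithLp.toLp 2 ![H (Torus.repr x 1), 0]
        else WithLp.toLp 2 ![0, H (Torus.repr x 0)] := by
  funext y
  ext i
  fin_cases i <;> simp

/-- The vertical parallel profile `H(x₁) e₂` in the normal form of `ShearCombDatum _ false`. -/
theorem parallel_false_eq (H : ℝ → ℝ) :
    (fun y : UnitAddTorus (Fin 2) => H (Torus.repr y 0) • EuclideanSpace.single (1 : Fin 2) (1 : ℝ)) =
      fun x => if false then WithLp.toLp 2 ![H (Torus.repr x 1), 0]
        else WithLp.toLp 2 ![0, H (Torus.repr x 0)] := by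
  funext y
  ext i
  fin_cases i <;> simp

/-- **The residual comb class is invariant under the H half pulse (H injections).** For `δ₀ > 0`,
`d > 0`, `ν > 0`: if `w₀` is a horizontal residual comb of frequency `N_j` (`ShearCombDatum (P.N j) true w₀`:
`w₀ = g(x₂) e₁`, `g` smooth, `1`-periodic, Fourier-supported on the odd multiples of `N_j`) and `(w, q)`
is a classical solution of the Navier–Stokes equations linearised at the cascade carrier on the H
half-slot of phase `j` with `w(tStart j) = w₀`, then at every time `t` of the slot `w(t)` is again a
horizontal residual comb of frequency `N_j` — `ShearCombDatum (P.N j) true (w t)` — and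
`‖w(t)‖²_{L²} ≤ ‖w₀‖²_{L²}`.  (The response is the parallel heat flow `h(t, x₂) e₁`,
`parallel_H_unique`; the heat flow preserves vanishing Fourier moments, `heatProfile_moments_eq_zero`.) -/
theorem shearCombDatum_parallel_H (P : CascadeParams) (hδ₀ : 0 < P.δ₀) (hd : 0 < P.d) {j : ℕ} {ν : ℝ}
    (hν : 0 < ν) {w₀ : UnitAddTorus (Fin 2) → EuclideanSpace ℝ (Fin 2)}
    (hdat : ShearCombDatum (P.N j) true w₀)
    {w : ℝ → UnitAddTorus (Fin 2) → EuclideanSpace ℝ (Fin 2)} {q : ℝ → UnitAddTorus (Fin 2) → ℝ}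
    (hw : Torus.IsSmoothSpaceTimeOn (Icc (tStart j) (tStart j + tHalf j)) w)
    (hq : Torus.IsSmoothSpaceTimeOn (Icc (tStart j) (tStart j + tHalf j)) q)
    (hwdiv : ∀ t ∈ Icc (tStart j) (tStart j + tHalf j), Torus.IsDivFree (w t))
    (hlin : ∀ t ∈ Icc (tStart j) (tStart j + tHalf j), ∀ x,
      Torus.timeDerivWithin (Icc (tStart j) (tStart j + tHalf j)) w t x + Torus.convect (P.field t) (w t) x +
        Torus.convect (w t) (P.field t) x = ν • Torus.laplacian (w t) x - Torus.gradient (q t) x)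
    (h0 : w (tStart j) = w₀) {t : ℝ} (ht : t ∈ Icc (tStart j) (tStart j + tHalf j)) :
    ShearCombDatum (P.N j) true (w t) ∧ Torus.vectorL2Sq (w t) ≤ Torus.vectorL2Sq w₀ := by
  have hlt : tStart j < tStart j + tHalf j := by linarith [tHalf_pos j]
  obtain ⟨g, hg, hgper, hsupp, hw₀⟩ := hdat
  obtain ⟨h, hh, hper, heat, ha⟩ := exists_heatProfile hlt hν hg hgper
  have h0' : w (tStart j) = fun y => h (tStart j) (Torus.repr y 1) • EuclideanSpace.single (0 : Fin 2) (1 : ℝ) := by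
    rw [h0, hw₀, ← parallel_true_eq g, ha]
  obtain ⟨heq, hle⟩ := parallel_H_unique P hδ₀ hd hν.le hh hper heat hw hq hwdiv hlin h0' ht
  refine ⟨⟨h t, contDiff_slice_of_contDiffOn_uncurry hh ht, hper t ht, fun m hm => ?_, ?_⟩, ?_⟩
  · have hz := hsupp m hm
    rw [← ha] at hz
    exact heatProfile_moments_eq_zero hlt hh hper heat hz.1 hz.2 ht
  · rw [heq, parallel_true_eq]
  · rw [← h0]
    exact hle

/-- **The residual comb class is invariant under the V half pulse (V injections)**: as
`shearCombDatum_parallel_H` on the V half-slot `[tStart j + tHalf j, tStart (j+1)]` for a vertical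
residual comb `w₀ = g(x₁) e₂` of frequency `N_j` injected at `tStart j + tHalf j`. -/
theorem shearCombDatum_parallel_V (P : CascadeParams) (hδ₀ : 0 < P.δ₀) (hd : 0 < P.d) {j : ℕ} {ν : ℝ}
    (hν : 0 < ν) {w₀ : UnitAddTorus (Fin 2) → EuclideanSpace ℝ (Fin 2)}
    (hdat : ShearCombDatum (P.N j) false w₀)
    {w : ℝ → UnitAddTorus (Fin 2) → EuclideanSpace ℝ (Fin 2)} {q : ℝ → UnitAddTorus (Fin 2) → ℝ}
    (hw : Torus.IsSmoothSpaceTimeOn (Icc (tStart j + tHalf j) (tStart (j + 1))) w)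
    (hq : Torus.IsSmoothSpaceTimeOn (Icc (tStart j + tHalf j) (tStart (j + 1))) q)
    (hwdiv : ∀ t ∈ Icc (tStart j + tHalf j) (tStart (j + 1)), Torus.IsDivFree (w t))
    (hlin : ∀ t ∈ Icc (tStart j + tHalf j) (tStart (j + 1)), ∀ x,
      Torus.timeDerivWithin (Icc (tStart j + tHalf j) (tStart (j + 1))) w t x +
        Torus.convect (P.field t) (w t) x + Torus.convect (w t) (P.field t) x =
          ν • Torus.laplacian (w t) x - Torus.gradient (q t) x)
    (h0 : w (tStart j + tHalf j) = w₀) {t : ℝ} (ht : t ∈ Icc (tStart j + tHalf j) (tStart (j + 1))) :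
    ShearCombDatum (P.N j) false (w t) ∧ Torus.vectorL2Sq (w t) ≤ Torus.vectorL2Sq w₀ := by
  have hlt : tStart j + tHalf j < tStart (j + 1) := by rw [tStart_succ]; linarith [tHalf_pos j]
  obtain ⟨g, hg, hgper, hsupp, hw₀⟩ := hdat
  obtain ⟨h, hh, hper, heat, ha⟩ := exists_heatProfile hlt hν hg hgper
  have h0' : w (tStart j + tHalf j) =
      fun y => h (tStart j + tHalf j) (Torus.repr y 0) • EuclideanSpace.single (1 : Fin 2) (1 : ℝ) := by
    rw [h0, hw₀, ← parallel_false_eq g, ha]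
  obtain ⟨heq, hle⟩ := parallel_V_unique P hδ₀ hd hν.le hh hper heat hw hq hwdiv hlin h0' ht
  refine ⟨⟨h t, contDiff_slice_of_contDiffOn_uncurry hh ht, hper t ht, fun m hm => ?_, ?_⟩, ?_⟩
  · have hz := hsupp m hm
    rw [← ha] at hz
    exact heatProfile_moments_eq_zero hlt hh hper heat hz.1 hz.2 ht
  · rw [heq, parallel_false_eq]
  · rw [← h0]
    exact hle

/-! ## §5 In the shape of the K2″ injection windows (stubs A/B of the line `phase-cocycle`) -/

/-- **H injection window, H half: the comb class survives.** Under the hypotheses of the registered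
stub `stub_injectionPhase` with `hz = true` (classical linearised response `(w, q)` on
`[tInject j₀ true, tStart (j₀+1)]` to a horizontal residual comb `w₀` of frequency `N_{j₀}`), at every
time `t` of the H half-slot `[tStart j₀, tStart j₀ + tHalf j₀]` the state `w(t)` is again a horizontal
residual comb of frequency `N_{j₀}` with `‖w(t)‖² ≤ ‖w₀‖²` — so the V half of the injection phase (the
open part of stub A) acts on a comb datum PERPENDICULAR to its pulse, at relative streamwise wavenumbers
the odd multiples of `N_{j₀}/N_{j₀} = 1`. -/
theorem k2_injection_H_comb (P : CascadeParams) (hδ₀ : 0 < P.δ₀) (hd : 0 < P.d) {ν : ℝ}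
    (hν : 0 < ν) (j₀ : ℕ) (w₀ : UnitAddTorus (Fin 2) → EuclideanSpace ℝ (Fin 2))
    (w : ℝ → UnitAddTorus (Fin 2) → EuclideanSpace ℝ (Fin 2)) (q : ℝ → UnitAddTorus (Fin 2) → ℝ)
    (hdat : ShearCombDatum (P.N j₀) true w₀)
    (hw : Torus.IsSmoothSpaceTimeOn (Icc (CascadeParams.tInject j₀ true) (tStart (j₀ + 1))) w)
    (hq : Torus.IsSmoothSpaceTimeOn (Icc (CascadeParams.tInject j₀ true) (tStart (j₀ + 1))) q)
    (hdiv : ∀ t ∈ Icc (CascadeParams.tInject j₀ true) (tStart (j₀ + 1)), Torus.IsDivFree (w t))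
    (hlin : ∀ t ∈ Icc (CascadeParams.tInject j₀ true) (tStart (j₀ + 1)), ∀ x,
      Torus.timeDerivWithin (Icc (CascadeParams.tInject j₀ true) (tStart (j₀ + 1))) w t x +
        Torus.convect (P.field t) (w t) x + Torus.convect (w t) (P.field t) x =
          ν • Torus.laplacian (w t) x - Torus.gradient (q t) x)
    (h0 : w (CascadeParams.tInject j₀ true) = w₀)
    {t : ℝ} (ht : t ∈ Icc (tStart j₀) (tStart j₀ + tHalf j₀)) :
    ShearCombDatum (P.N j₀) true (w t) ∧ Torus.vectorL2Sq (w t) ≤ Torus.vectorL2Sq w₀ := by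
  have hsub := Icc_H_subset_window j₀
  have hlt : tStart j₀ < tStart j₀ + tHalf j₀ := by linarith [tHalf_pos j₀]
  have hlin' : ∀ s ∈ Icc (tStart j₀) (tStart j₀ + tHalf j₀), ∀ x,
      Torus.timeDerivWithin (Icc (tStart j₀) (tStart j₀ + tHalf j₀)) w s x +
        Torus.convect (P.field s) (w s) x + Torus.convect (w s) (P.field s) x =
          ν • Torus.laplacian (w s) x - Torus.gradient (q s) x := by
    intro s hs x
    rw [timeDerivWithin_Icc_eq_of_subset_C hlt hsub hw hs x]
    exact hlin s (hsub hs) x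
  rw [tInject_true] at h0
  exact shearCombDatum_parallel_H P hδ₀ hd hν hdat (hw.mono hsub) (hq.mono hsub)
    (fun s hs => hdiv s (hsub hs)) hlin' h0 ht

/-- **V injection window: the comb class survives the whole injection phase.** Under the hypotheses of
the registered stub `stub_injectionPhase` with `hz = false` (the window `[tInject j₀ false, tStart (j₀+1)]`
IS the V half-slot of phase `j₀`), at every time of the window `w(t)` is again a vertical residual comb of
frequency `N_{j₀}` with `‖w(t)‖² ≤ ‖w₀‖²`. -/
theorem k2_injection_V_comb (P : CascadeParams) (hδ₀ : 0 < P.δ₀) (hd : 0 < P.d) {ν : ℝ}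
    (hν : 0 < ν) (j₀ : ℕ) (w₀ : UnitAddTorus (Fin 2) → EuclideanSpace ℝ (Fin 2))
    (w : ℝ → UnitAddTorus (Fin 2) → EuclideanSpace ℝ (Fin 2)) (q : ℝ → UnitAddTorus (Fin 2) → ℝ)
    (hdat : ShearCombDatum (P.N j₀) false w₀)
    (hw : Torus.IsSmoothSpaceTimeOn (Icc (CascadeParams.tInject j₀ false) (tStart (j₀ + 1))) w)
    (hq : Torus.IsSmoothSpaceTimeOn (Icc (CascadeParams.tInject j₀ false) (tStart (j₀ + 1))) q)
    (hdiv : ∀ t ∈ Icc (CascadeParams.tInject j₀ false) (tStart (j₀ + 1)), Torus.IsDivFree (w t))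
    (hlin : ∀ t ∈ Icc (CascadeParams.tInject j₀ false) (tStart (j₀ + 1)), ∀ x,
      Torus.timeDerivWithin (Icc (CascadeParams.tInject j₀ false) (tStart (j₀ + 1))) w t x +
        Torus.convect (P.field t) (w t) x + Torus.convect (w t) (P.field t) x =
          ν • Torus.laplacian (w t) x - Torus.gradient (q t) x)
    (h0 : w (CascadeParams.tInject j₀ false) = w₀)
    {t : ℝ} (ht : t ∈ Icc (CascadeParams.tInject j₀ false) (tStart (j₀ + 1))) :
    ShearCombDatum (P.N j₀) false (w t) ∧ Torus.vectorL2Sq (w t) ≤ Torus.vectorL2Sq w₀ := by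
  have hI : CascadeParams.tInject j₀ false = tStart j₀ + tHalf j₀ := by
    simp only [CascadeParams.tInject, Bool.false_eq_true, ↓reduceIte]
  rw [hI] at hw hq hdiv hlin h0 ht
  exact shearCombDatum_parallel_V P hδ₀ hd hν hdat hw hq hdiv hlin h0 ht

/-- **The datum handed to the first CROSS pulse after a V injection**: at `tStart (j₀+1)`, the start of
the H half-slot of phase `j₀ + 1`, the response to a vertical residual-comb injection at phase `j₀` is a
vertical residual comb of frequency `N_{j₀}` (relative streamwise wavenumbers: the odd multiples of
`N_{j₀}/N_{j₀+1} = 1/ρN`) with `‖w‖² ≤ ‖w₀‖²` — the input of stub B's first one-phase transfer. -/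
theorem k2_injection_V_comb_next (P : CascadeParams) (hδ₀ : 0 < P.δ₀) (hd : 0 < P.d) {ν : ℝ}
    (hν : 0 < ν) (j₀ : ℕ) (w₀ : UnitAddTorus (Fin 2) → EuclideanSpace ℝ (Fin 2))
    (w : ℝ → UnitAddTorus (Fin 2) → EuclideanSpace ℝ (Fin 2)) (q : ℝ → UnitAddTorus (Fin 2) → ℝ)
    (hdat : ShearCombDatum (P.N j₀) false w₀)
    (hw : Torus.IsSmoothSpaceTimeOn (Icc (CascadeParams.tInject j₀ false) (tStart (j₀ + 1))) w)
    (hq : Torus.IsSmoothSpaceTimeOn (Icc (CascadeParams.tInject j₀ false) (tStart (j₀ + 1))) q)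
    (hdiv : ∀ t ∈ Icc (CascadeParams.tInject j₀ false) (tStart (j₀ + 1)), Torus.IsDivFree (w t))
    (hlin : ∀ t ∈ Icc (CascadeParams.tInject j₀ false) (tStart (j₀ + 1)), ∀ x,
      Torus.timeDerivWithin (Icc (CascadeParams.tInject j₀ false) (tStart (j₀ + 1))) w t x +
        Torus.convect (P.field t) (w t) x + Torus.convect (w t) (P.field t) x =
          ν • Torus.laplacian (w t) x - Torus.gradient (q t) x)
    (h0 : w (CascadeParams.tInject j₀ false) = w₀) :
    ShearCombDatum (P.N j₀) false (w (tStart (j₀ + 1))) ∧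
      Torus.vectorL2Sq (w (tStart (j₀ + 1))) ≤ Torus.vectorL2Sq w₀ :=
  k2_injection_V_comb P hδ₀ hd hν j₀ w₀ w q hdat hw hq hdiv hlin h0
    ⟨(tInject_lt_tStart_succ j₀ false).le, le_rfl⟩


end Summit.AnomalousDissipation.AnomalousDissipation.Theorems.SawtoothPulseCascade.K2Classical

end
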